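import Summits.RiemannHypothesis.RiemannHypothesis.Theorems.Splittings.NbTargetsDilation
import HarnessLib

/-!
# RH-EQUIVALENT·SPLITTING CENSUS (nb, neg) · V44 «DILATIONS > 1 / WIENER COLLAPSE», part B:
a BOUNDED menu of expanding dilations is a costume — NB(`{q^j/(k+1) : j < J}`) `⟺` RH; nothing
here bears on the truth of RH

LABEL (line 1): RH-EQUIVALENT·SPLITTING (cell `rh-split`, seat (nb, neg), generation 19, census
candidate V44, bounded half).  For integers `q ≥ 1`, `J ≥ 1` write NB(q, J) for
«`χ = 𝟙_(0,1]` is an `L²(0,∞)`-limit of real combinations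
`∑_{j<J} ∑_{k<N} c_{jk} {q^j/((k+1)x)}`» (Báez-Duarte's menu `{1/(k+1)}` together with its
expansions by `q, q², …, q^{J-1}`; `ε`-form spelled out as in
`Literature.NumberTheory.LFunctions.baezDuarte_iff`).

* `nb_pow_dilations_iff` : NB(q, J) `⟺` RH for every `q ≥ 1`, `J ≥ 1`.  `⟸`: `J = 1`, `j = 0` is
  Báez-Duarte's theorem (`baezDuarte_iff_holds`).  `⟹` (RH-free): the substitution `x ↦ q^{J-1}x`
  maps `{q^j/((k+1)x)}` to `{1/((k+1)q^{J-1-j}·x)}` — back into the natural menu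
  (`sum_pow_dilates_eq`, from the tree's `sum_dilate_eq`) — and `χ` to `𝟙_(0,q^{1-J}]`, dividing
  `L²` norms by `q^{(J-1)/2} ≥ 1` (`eLpNorm_comp_mul_left_Ioi`); so NB(q, J) gives
  TARGET(`𝟙_(0,1/q^{J-1}]`), which is `⟺` RH by the census row V39
  (`NbTargets.nbTarget_indicator_iff`, zero-confinement).

Read together with part A (`NbDilationA.nb_dilations_pow`: for real `q > 1` the menu with ALL
powers `q^j`, `j ∈ ℕ`, collapses unconditionally): on the dilation axis the RH content of `E_NB`
is exactly the BOUNDEDNESS of the dilation menu.  Kernel hygiene: no `sorry`, no new axioms, no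
`private`, no instances, no notation.
-/

open MeasureTheory Set Filter

set_option linter.dupNamespace false

namespace Summit.RiemannHypothesis.RiemannHypothesis.Theorems.Splittings.NbDilation

open Literature.NumberTheory.LFunctions
  Summit.RiemannHypothesis.RiemannHypothesis.Theorems.Splittings.NbTargets

/-- The dilation identity behind part B: for `j ≤ J - 1`, `q ≥ 1`,
`q^j/(a·(q^{J-1}x)) = 1/(a·(q^{J-1-j}x))`. [folklore] -/
theorem pow_div_pow_mul_eq {q : ℕ} (hq : 0 < q) {J j : ℕ} (hj : j ≤ J - 1) (a x : ℝ) :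
    (q : ℝ) ^ j / (a * ((q : ℝ) ^ (J - 1) * x)) = 1 / (a * ((q : ℝ) ^ (J - 1 - j) * x)) := by
  have hqj : (q : ℝ) ^ j ≠ 0 := pow_ne_zero _ (by exact_mod_cast hq.ne')
  have hsplit : (q : ℝ) ^ (J - 1) = (q : ℝ) ^ j * (q : ℝ) ^ (J - 1 - j) := by
    rw [← pow_add, Nat.add_sub_cancel' hj]
  rw [hsplit, show a * ((q : ℝ) ^ j * (q : ℝ) ^ (J - 1 - j) * x) =
    (q : ℝ) ^ j * (a * ((q : ℝ) ^ (J - 1 - j) * x)) by ring, div_mul_eq_div_div, div_self hqj]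

/-- **Expanding dilations fold back into the natural menu.**  With `M = q^{J-1}N` and
`c'_i = ∑_{j<J} ∑_{k<N} [ (k+1)q^{J-1-j} = i+1 ] c_{jk}`:
`∑_{i<M} c'_i {1/((i+1)x)} = ∑_{j<J}∑_{k<N} c_{jk} {q^j/((k+1)q^{J-1}x)}` (tree `sum_dilate_eq`,
one power at a time). [folklore] -/
theorem sum_pow_dilates_eq {q J N : ℕ} (hq : 0 < q) (c : Fin J → Fin N → ℝ) (x : ℝ) :
    ∑ i : Fin (q ^ (J - 1) * N), (∑ j : Fin J, ∑ k : Fin N,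
        if ((k : ℕ) + 1) * q ^ (J - 1 - (j : ℕ)) = (i : ℕ) + 1 then c j k else 0) *
        Int.fract (1 / (((i : ℕ) + 1 : ℝ) * x)) =
      ∑ j : Fin J, ∑ k : Fin N, c j k *
        Int.fract ((q : ℝ) ^ (j : ℕ) / ((((k : ℕ) : ℝ) + 1) * ((q : ℝ) ^ (J - 1) * x))) := by
  calc ∑ i : Fin (q ^ (J - 1) * N), (∑ j : Fin J, ∑ k : Fin N,
        if ((k : ℕ) + 1) * q ^ (J - 1 - (j : ℕ)) = (i : ℕ) + 1 then c j k else 0) *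
        Int.fract (1 / (((i : ℕ) + 1 : ℝ) * x))
      = ∑ i : Fin (q ^ (J - 1) * N), ∑ j : Fin J, (∑ k : Fin N,
          if ((k : ℕ) + 1) * q ^ (J - 1 - (j : ℕ)) = (i : ℕ) + 1 then c j k else 0) *
          Int.fract (1 / (((i : ℕ) + 1 : ℝ) * x)) :=
        Finset.sum_congr rfl fun i _ ↦ Finset.sum_mul _ _ _
    _ = ∑ j : Fin J, ∑ i : Fin (q ^ (J - 1) * N), (∑ k : Fin N,
          if ((k : ℕ) + 1) * q ^ (J - 1 - (j : ℕ)) = (i : ℕ) + 1 then c j k else 0) *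
          Int.fract (1 / (((i : ℕ) + 1 : ℝ) * x)) := Finset.sum_comm
    _ = _ := by
        refine Finset.sum_congr rfl fun j _ ↦ ?_
        have hj : (j : ℕ) ≤ J - 1 := Nat.le_sub_one_of_lt j.is_lt
        have hm : 0 < q ^ (J - 1 - (j : ℕ)) := pow_pos hq _
        have hM : q ^ (J - 1 - (j : ℕ)) * N ≤ q ^ (J - 1) * N :=
          Nat.mul_le_mul_right _ (Nat.pow_le_pow_right hq (Nat.sub_le _ _))
        rw [sum_dilate_eq (c j) hm hM x]
        refine Finset.sum_congr rfl fun k _ ↦ ?_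
        rw [pow_div_pow_mul_eq hq hj]
        push_cast
        rfl

/-- **RH-EQUIVALENT — a bounded menu of expanding dilations is a costume.**  For integers
`q ≥ 1`, `J ≥ 1`: «`𝟙_(0,1]` is an `L²(0,∞)`-limit of real combinations
`∑_{j<J}∑_{k<N} c_{jk}{q^j/((k+1)x)}`» `⟺` RH.  `⟸`: the `j = 0` layer is Báez-Duarte's theorem
(`baezDuarte_iff_holds`).  `⟹` (RH-free): dilating by `q^{J-1}` folds the menu back into
`{1/(i+1)}` (`sum_pow_dilates_eq`) and turns `χ` into `𝟙_(0,q^{1-J}]`, an RH-equivalent target by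
the census row V39 (`nbTarget_indicator_iff`, zero confinement).  Contrast part A: with ALL powers
`q^j` (`j ∈ ℕ`, `q > 1`) the closure holds unconditionally.
[cite: BaezDuarte2003, Thm. 1.1; Balazard2020, Prop. 10 (i)] -/
theorem nb_pow_dilations_iff {q J : ℕ} (hq : 0 < q) (hJ : 0 < J) :
    (∀ ε : ℝ, 0 < ε → ∃ (N : ℕ) (c : Fin J → Fin N → ℝ),
      eLpNorm (fun x : ℝ ↦ (Ioc (0 : ℝ) 1).indicator 1 x -
          ∑ j : Fin J, ∑ k : Fin N, c j k *
            Int.fract ((q : ℝ) ^ (j : ℕ) / ((((k : ℕ) : ℝ) + 1) * x))) 2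
        (volume.restrict (Ioi 0)) < ENNReal.ofReal ε) ↔ RiemannHypothesis := by
  have hm : 0 < q ^ (J - 1) := pow_pos hq _
  have hq1 : (1 : ℝ) ≤ q := by exact_mod_cast hq
  have hmR : (0 : ℝ) < (q : ℝ) ^ (J - 1) := pow_pos (by linarith) _
  have hm1 : (1 : ℝ) ≤ (q : ℝ) ^ (J - 1) := one_le_pow₀ hq1
  constructor
  · intro h
    refine (nbTarget_indicator_iff hm).1 fun ε hε ↦ ?_
    obtain ⟨N, c, hN⟩ := h ε hε
    refine ⟨q ^ (J - 1) * N, fun i ↦ ∑ j : Fin J, ∑ k : Fin N,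
      if ((k : ℕ) + 1) * q ^ (J - 1 - (j : ℕ)) = (i : ℕ) + 1 then c j k else 0, ?_⟩
    set D : ℝ → ℝ := fun x ↦ (Ioc (0 : ℝ) 1).indicator 1 x -
      ∑ j : Fin J, ∑ k : Fin N, c j k *
        Int.fract ((q : ℝ) ^ (j : ℕ) / ((((k : ℕ) : ℝ) + 1) * x)) with hD
    have hDm : Measurable D := by
      refine ((measurable_const (a := (1 : ℝ))).indicator measurableSet_Ioc).sub ?_
      refine Finset.measurable_sum _ fun j _ ↦ Finset.measurable_sum _ fun k _ ↦ ?_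
      exact ((measurable_const.div (measurable_const.mul measurable_id)).fract).const_mul _
    have hscale : eLpNorm (fun x ↦ D ((q : ℝ) ^ (J - 1) * x)) 2 (volume.restrict (Ioi 0)) <
        ENNReal.ofReal ε := by
      rw [eLpNorm_comp_mul_left_Ioi hDm hmR]
      calc ENNReal.ofReal ((q : ℝ) ^ (J - 1))⁻¹ ^ (1 / 2 : ℝ) * eLpNorm D 2 (volume.restrict (Ioi 0))
          ≤ 1 * eLpNorm D 2 (volume.restrict (Ioi 0)) := by
            gcongr
            exact ENNReal.rpow_le_one (ENNReal.ofReal_le_one.2 (inv_le_one_of_one_le₀ hm1))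
              (by norm_num)
        _ < ENNReal.ofReal ε := by rw [one_mul]; exact hN
    refine lt_of_le_of_lt (le_of_eq (eLpNorm_congr_ae (Eventually.of_forall fun x ↦ ?_))) hscale
    simp only [hD]
    rw [sum_pow_dilates_eq hq c x]
    push_cast
    rw [indicator_Ioc_dilate hmR x]
  · intro hRH ε hε
    obtain ⟨N, c₀, hN⟩ := baezDuarte_iff_holds.1 hRH ε hε
    refine ⟨N, fun j k ↦ if (j : ℕ) = 0 then c₀ k else 0, ?_⟩
    refine lt_of_le_of_lt (le_of_eq (eLpNorm_congr_ae (Eventually.of_forall fun x ↦ ?_))) hN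
    simp only
    congr 1
    rw [Finset.sum_eq_single ⟨0, hJ⟩]
    · simp
    · intro j _ hj
      have hj0 : (j : ℕ) ≠ 0 := fun h ↦ hj (Fin.ext h)
      simp [hj0]
    · intro h
      exact absurd (Finset.mem_univ _) h

end Summit.RiemannHypothesis.RiemannHypothesis.Theorems.Splittings.NbDilation
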